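import Summits.QuantumFields.YangMills.Theorems.FemtoTransferGap
import HarnessLib

/-!
# Route `FlatTubeReduction` — DEFINITIONS: the two independent halves of stub 2 of crux `PinnedUnitStepEx` (stmt-QuantumFields-27561)

Seat leafhand-qf-flattubereduction-1 g0 (2026-08-30).  The registered hard stub `PinnedAutocorrExTI1` of skeleton «ti-split-1» v2
(`Theorems/FlatTubeReductionPinnedUnitStepExDefs.lean`) is the conjunction of an EXISTENCE claim (P1: the first zero-flux excitation of the coarse
transfer operator has a zero-momentum member along the femto window) and a COMPARISON claim (P2: the one-slab two-cutoff one-step autocorrelation bound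
for the smeared trial).  The split door `TISplit1.pinnedAutocorrExTI1_of_zeroAvgBound_of_oneStep` (`Theorems/FlatTubeReductionPinnedUnitStepExSplitDoor.lean`,
p793860/p794159) proves `NonZeroMomentumGapTI1 → OneStepPinnedComparisonTI1 → PinnedAutocorrExTI1` — its two hypotheses are, VERBATIM, the two Props
named here, so that a planner may register them as separate stubs of a «ti-split-1» v3 skeleton (candidate file attached as evidence on the item):

* `NonZeroMomentumGapTI1` (P1, spectral-bound form; size L): along the window, the physical zero-flux states `⊥ Ω′` with identically vanishing
  translation average lie strictly below `secondValue′` in transfer form (`∃ θ < λ₁′`) — Lüscher's «non-zero momenta cost `O(2π)/L′`, the zero-momentum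
  excitation `ε₁λ/L′`»; by `ZeroMomentum.exists_ti_secondEigen_of_zeroAvg_bound` it yields the translation-invariant `secondValue′`-eigenfunction.
* `OneStepPinnedComparisonTI1` (P2, size XL — the two-cutoff wall, class `Literature.Barriers.QuantumFields.UVStabilityNonUniqueness`): the one-step
  comparison of the one-step door (p644937) for EVERY translation-invariant normalised coarse `secondValue′`-eigenfunction `φ′ ⊥ Ω′`.

Definitions only (OPEN claims of the route, NOT literature facts); R2b1 is a RECORD rung; nothing here proves any stub, crux or summit.
-/

set_option autoImplicit false

namespace Summit.QuantumFields.YangMills.Cruxes.PinnedUnitStepEx.TISplit1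

open MeasureTheory
open Summit.QuantumFields.YangMills.Theorems.FemtoTransferGap

/-- (P1) of stub 2 of crux `PinnedUnitStepEx` (stmt-QuantumFields-27561; an OPEN claim of the route, NOT a literature fact): along the femto window,
for the coarse ground state `Ω′`, some `θ < secondValue′` bounds the transfer form of every physical zero-flux `ψ ⊥ Ω′` whose translation average
vanishes identically — the non-zero-momentum states lie strictly below the first excitation.  (Route-posited; physical picture after Lüscher 1983 §3:
non-zero momenta cost `O(2π)/L′`, the zero-momentum excitation `ε₁λ/L′`.) -/
def NonZeroMomentumGapTI1 : Prop :=
  ∃ lam1 : ℝ, 0 < lam1 ∧ ∀ lam : ℝ, 0 < lam → lam ≤ lam1 → ∃ L1 : ℕ, ∀ (L' : ℕ) [NeZero L'], L1 ≤ L' → ∀ β' : ℝ,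
    InFemtoWindow lam β' L' →
    ∀ Ω' : Literature.MathematicalPhysics.QuantumFieldTheory.GaugeConfig 3 L' SU2 → ℝ, IsPhys Ω' → ∀ c' : ℝ, 0 < c' → (∀ U', c' ≤ Ω' U') →
    l2 Ω' Ω' = 1 →
    (∀ U', ∫ V', transferKernel su2Rep β' U' V' * Ω' V' ∂(configMeasure SU2 L') = topValue su2Rep L' β' * Ω' U') →
    ∃ θ : ℝ, θ < secondValue su2Rep L' β' ∧
      ∀ ψ : Literature.MathematicalPhysics.QuantumFieldTheory.GaugeConfig 3 L' SU2 → ℝ, IsPhys ψ →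
        (∀ U' : Literature.MathematicalPhysics.QuantumFieldTheory.GaugeConfig 3 L' SU2,
          (Fintype.card (Literature.MathematicalPhysics.QuantumFieldTheory.Site 3 L') : ℝ)⁻¹ *
            ∑ v' : Literature.MathematicalPhysics.QuantumFieldTheory.Site 3 L', ψ (fun e => U' (e.1 - v', e.2)) = 0) →
        l2 ψ Ω' = 0 → qform su2Rep β' ψ ψ ≤ θ * l2 ψ ψ

/-- (P2) of stub 2 of crux `PinnedUnitStepEx` (stmt-QuantumFields-27561; an OPEN crux-level claim of the route, NOT a literature fact): the ONE-STEP
one-slab pinned comparison `λ₁′^{L′}·λ₀^{L′+1}·V^{L′+1} ≤ e^{CΛ²/L′}·λ₀′^{L′}·R₁^{L′+1}` for the smeared trial `ψ = fbar·Ω` of EVERY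
translation-invariant normalised coarse `secondValue′`-eigenfunction `φ′ ⊥ Ω′` (the hypothesis `hP2` of the split door, verbatim).
(Route-posited; trial-state mechanism after Lüscher 1983 §3, one-slab averaging after Bałaban 1985 §1.) -/
def OneStepPinnedComparisonTI1 : Prop :=
  ∃ C lam2 : ℝ, 0 < lam2 ∧ ∀ lam : ℝ, 0 < lam → lam ≤ lam2 → ∃ L2 : ℕ, ∀ (L' : ℕ) [NeZero L'], L2 ≤ L' → ∀ β β' : ℝ,
    InFemtoWindow lam β (L' + 1) → InFemtoWindow lam β' L' → luscherLambda β (L' + 1) = luscherLambda β' L' →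
    ∀ Ω : Literature.MathematicalPhysics.QuantumFieldTheory.GaugeConfig 3 (L' + 1) SU2 → ℝ, IsPhys Ω → (∀ U, 0 < Ω U) → l2 Ω Ω = 1 →
    (∀ U, ∫ V, transferKernel su2Rep β U V * Ω V ∂(configMeasure SU2 (L' + 1)) = topValue su2Rep (L' + 1) β * Ω U) →
    ∀ Ω' : Literature.MathematicalPhysics.QuantumFieldTheory.GaugeConfig 3 L' SU2 → ℝ, IsPhys Ω' → ∀ c' : ℝ, 0 < c' → (∀ U', c' ≤ Ω' U') →
    l2 Ω' Ω' = 1 →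
    (∀ U', ∫ V', transferKernel su2Rep β' U' V' * Ω' V' ∂(configMeasure SU2 L') = topValue su2Rep L' β' * Ω' U') →
    ∀ φ' : Literature.MathematicalPhysics.QuantumFieldTheory.GaugeConfig 3 L' SU2 → ℝ, IsPhys φ' →
      (∀ (v' : Literature.MathematicalPhysics.QuantumFieldTheory.Site 3 L')
        (U' : Literature.MathematicalPhysics.QuantumFieldTheory.GaugeConfig 3 L' SU2), φ' (fun e => U' (e.1 - v', e.2)) = φ' U') →
      l2 φ' Ω' = 0 → l2 φ' φ' = 1 →
      (∀ U', ∫ V', transferKernel su2Rep β' U' V' * φ' V' ∂(configMeasure SU2 L') = secondValue su2Rep L' β' * φ' U') →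
      let T : Literature.MathematicalPhysics.QuantumFieldTheory.GaugeConfig 3 (L' + 1) SU2 →
          Literature.MathematicalPhysics.QuantumFieldTheory.GaugeConfig 3 L' SU2 := fun U e' =>
        (List.ofFn fun t : Fin (if (e'.1 e'.2).val < L' + 1 - L' then 2 else 1) =>
          U ((fun j => (((e'.1 j).val + min (e'.1 j).val (L' + 1 - L') : ℕ) : ZMod (L' + 1))) +
            Pi.single e'.2 ((t : ℕ) : ZMod (L' + 1)), e'.2)).prod
      let fbar : Literature.MathematicalPhysics.QuantumFieldTheory.GaugeConfig 3 (L' + 1) SU2 → ℝ := fun U =>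
        (Fintype.card (Literature.MathematicalPhysics.QuantumFieldTheory.Site 3 (L' + 1)) : ℝ)⁻¹ *
          ∑ v : Literature.MathematicalPhysics.QuantumFieldTheory.Site 3 (L' + 1),
            φ' (T fun e => U (e.1 - v, e.2)) / Ω' (T fun e => U (e.1 - v, e.2))
      let ψ : Literature.MathematicalPhysics.QuantumFieldTheory.GaugeConfig 3 (L' + 1) SU2 → ℝ := fun U => fbar U * Ω U
      let K : (Literature.MathematicalPhysics.QuantumFieldTheory.GaugeConfig 3 (L' + 1) SU2 → ℝ) →
          (Literature.MathematicalPhysics.QuantumFieldTheory.GaugeConfig 3 (L' + 1) SU2 → ℝ) := fun χ U =>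
        ∫ V, transferKernel su2Rep β U V * χ V ∂(configMeasure SU2 (L' + 1))
      secondValue su2Rep L' β' ^ L' * topValue su2Rep (L' + 1) β ^ (L' + 1) * (l2 ψ ψ - l2 ψ Ω ^ 2) ^ (L' + 1) ≤
        Real.exp (C * luscherLambda β (L' + 1) ^ 2 / (L' : ℝ)) *
          (topValue su2Rep L' β' ^ L' * (l2 ψ (K ψ) - topValue su2Rep (L' + 1) β * l2 ψ Ω ^ 2) ^ (L' + 1))

end Summit.QuantumFields.YangMills.Cruxes.PinnedUnitStepEx.TISplit1

/-! ## §2 (appended) The lam-UNIFORM momentum floor behind (P1) -/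

namespace Summit.QuantumFields.YangMills.Cruxes.PinnedUnitStepEx.TISplit1

open MeasureTheory
open Summit.QuantumFields.YangMills.Theorems.FemtoTransferGap

/-- **Non-zero-momentum energy FLOOR along the femto window** (an OPEN claim of the route, NOT a literature fact): there is `κ > 0` such that,
for every small level `lam`, all sufficiently fine `L′` and every window coupling `β′`, every physical zero-flux `ψ ⊥ Ω′` (coarse ground state `Ω′`)
with identically vanishing translation average has `⟨ψ, K_{β′}ψ⟩ ≤ e^{−κ/L′}·λ₀′·‖ψ‖²` — every non-zero-momentum state costs energy at least
`κ/L′` per lattice time step, UNIFORMLY in `lam` (physical picture: the momentum quantum `2π/L′` dominates the femto glueball energies `O(λ)/L′`;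
Lüscher 1983 §3, van Baal 2001 p. 9).  Together with the two-sided femto levels law `FemtoLevelsOfRecord` (node N34, `k = 1` lower half:
`λ₁′ ≥ e^{−(ε₁λ + Cλ²)/L′}λ₀′`) it yields `NonZeroMomentumGapTI1` for `lam` small (`ε₁λ + Cλ² < κ`) — theorem
`nonZeroMomentumGapTI1_of_levels_of_floor` in `Theorems/FlatTubeReductionPinnedUnitStepExMomentumFloor.lean`.  (Route-posited.) -/
def NonZeroMomentumFloorTI1 : Prop :=
  ∃ κ : ℝ, 0 < κ ∧ ∃ lam1 : ℝ, 0 < lam1 ∧ ∀ lam : ℝ, 0 < lam → lam ≤ lam1 → ∃ L1 : ℕ, ∀ (L' : ℕ) [NeZero L'], L1 ≤ L' → ∀ β' : ℝ,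
    InFemtoWindow lam β' L' →
    ∀ Ω' : Literature.MathematicalPhysics.QuantumFieldTheory.GaugeConfig 3 L' SU2 → ℝ, IsPhys Ω' → ∀ c' : ℝ, 0 < c' → (∀ U', c' ≤ Ω' U') →
    l2 Ω' Ω' = 1 →
    (∀ U', ∫ V', transferKernel su2Rep β' U' V' * Ω' V' ∂(configMeasure SU2 L') = topValue su2Rep L' β' * Ω' U') →
    ∀ ψ : Literature.MathematicalPhysics.QuantumFieldTheory.GaugeConfig 3 L' SU2 → ℝ, IsPhys ψ →
      (∀ U' : Literature.MathematicalPhysics.QuantumFieldTheory.GaugeConfig 3 L' SU2,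
        (Fintype.card (Literature.MathematicalPhysics.QuantumFieldTheory.Site 3 L') : ℝ)⁻¹ *
          ∑ v' : Literature.MathematicalPhysics.QuantumFieldTheory.Site 3 L', ψ (fun e => U' (e.1 - v', e.2)) = 0) →
      l2 ψ Ω' = 0 → qform su2Rep β' ψ ψ ≤ Real.exp (-κ / (L' : ℝ)) * topValue su2Rep L' β' * l2 ψ ψ

end Summit.QuantumFields.YangMills.Cruxes.PinnedUnitStepEx.TISplit1
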